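import Mathlib
import Summits.ValiantsHypothesis.ValiantsHypothesis.Theorems.RigidityForcesSymmetryRankRigidMinimalReprLaplaceFiveSeparatedCaptureReduction

/-!
# ValiantsHypothesis / RigidityForcesSymmetry — crux `LaplaceOptimalFive` (stmt-ValiantsHypothesis-24813), symmetric capture:
# **TWO NON-PROPORTIONAL LINES AND A PLANE: `finrank W ≤ 2`** (Case I of profile `(1,1,2)` of `CaptureIneqSym`)

Brick DIR (val-port-2 g5 ↔ crit-3 g8, 2026-08-29).  Let `U₀₁ = ℂ·u₁`, `U₀₂ = ℂ·u₂` with `u₁, u₂` symmetric and NOT proportional,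
and `U₁₂` symmetric of dimension `≤ 2`.  Every obligation reads `u₁(p,q)a_r + u₂(p,r)b_q + C_p(q,r)` and the `(1 2)` slot symmetry
gives the pencil equations `u₁(p,q)a_r − u₂(p,q)b_r = u₁(p,r)a_q − u₂(p,r)b_q`, i.e. `S := u₁ ⊗ a − u₂ ⊗ b` is a symmetric tensor with
all slices in the pencil `L = ⟨u₁, u₂⟩` (`S ∈ L⁽¹⁾`).  KEY: for a vector `w` with `u₁w ∦ u₂w` the contraction `∂_w : L⁽¹⁾ → L` is
injective — contracting the pencil equations against `w` gives `(u₁w)_p a_r − (u₂w)_p b_r = (a·w) u₁(p,r) − (b·w) u₂(p,r)`, and Cramer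
at two rows with a non-zero minor expresses `(a, b)` through the two scalars `(a·w, b·w)` (`pencil_cramer`).  Such a `w` exists among
`e_q + t e_{q′}`, `t ∈ {0, ±1}`: otherwise the `t`-coefficients give `D(pq,p′q′) = D(p′q,pq′)` for
`D(pq,p′q′) := u₁(p,q)u₂(p′,q′) − u₁(p′,q′)u₂(p,q)`, and the chain `D(pq,p′q′) = D(p′q,pq′) = D(qp′,q′p) = D(q′p′,qp) = −D(pq,p′q′)`
forces `D ≡ 0`, i.e. `u₁ ∥ u₂` (`exists_good_contraction`).  Hence all vector pairs `(a, b)` lie in a fixed span of two pairs and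
✓ `finrank_le_of_vectorPart` (brick R1) gives `finrank W ≤ 2 ≤ finrank U₀₁ + finrank U₀₂ + finrank U₁₂`.

* `exists_good_contraction` — `u₁ ∦ u₂` symmetric ⇒ some `w` has `u₁w ∦ u₂w`.
* `pencil_cramer` — the pencil equations contracted against `w`, solved at two rows.
* ★★ `finrank_le_two_of_nonproportional` — `finrank W ≤ 2`.
* ★★ `captureIneqSym_of_nonproportional_lines` — `CaptureIneqSym` for `(ℂu₁, ℂu₂, U₁₂)`, `u₁ ∦ u₂`, `finrank U₁₂ ≤ 2`
  (profiles `(1,1,0)`, `(1,1,1)`, `(1,1,2)` with the two lines distinct).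

Honest framing.  The equal-lines case `U₀₁ = U₀₂` with a plane (Case II), all profiles with two spans of dimension `≥ 2`, `CaptureIneqSym`
in general, K1 on `K₃ ⊔ K₂`, `LaplaceOptimalFive` (OPEN · CONTESTED 72/120) and `VP ≠ VNP` are NOT proved here.  No definitions, no `sorry`.
-/

set_option linter.dupNamespace false
set_option autoImplicit false

namespace Summit.ValiantsHypothesis.ValiantsHypothesis.Theorems.RigidityForcesSymmetryRankRigidMinimalRepr

namespace LaplaceFiveSeparatedCapture

open Finset

/-- Contraction of a row against the test vector `e_{q₀} + t·e_{q₀′}`. [folklore] -/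
theorem row_dot_test (u : Fin 5 → Fin 5 → ℂ) (p q₀ q₀' : Fin 5) (t : ℂ) :
    ∑ q, u p q * ((if q = q₀ then (1 : ℂ) else 0) + t * (if q = q₀' then (1 : ℂ) else 0)) = u p q₀ + t * u p q₀' := by
  simp only [mul_add, Finset.sum_add_distrib, mul_ite, mul_one, mul_zero, Finset.sum_ite_eq', Finset.mem_univ, if_true]
  ring

/-- **A good contraction exists.**  If `u₁, u₂` are symmetric and not proportional (some `2 × 2` minor of the pair of coefficient
vectors is non-zero), then for some vector `w` the two contracted vectors `u₁w, u₂w` are not proportional. [folklore] -/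
theorem exists_good_contraction (u₁ u₂ : Fin 5 → Fin 5 → ℂ)
    (hu₁ : ∀ p q, u₁ p q = u₁ q p) (hu₂ : ∀ p q, u₂ p q = u₂ q p)
    (hnp : ∃ i j k l, u₁ i j * u₂ k l ≠ u₁ k l * u₂ i j) :
    ∃ w : Fin 5 → ℂ, ∃ p₁ p₂ : Fin 5,
      (∑ q, u₁ p₁ q * w q) * (∑ q, u₂ p₂ q * w q) - (∑ q, u₁ p₂ q * w q) * (∑ q, u₂ p₁ q * w q) ≠ 0 := by
  obtain ⟨i, j, k, l, hne⟩ := hnp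
  by_contra h
  push Not at h
  -- the minor for `w = e_{q₀} + t e_{q₀′}` is a quadratic polynomial in `t` vanishing at `t = 1, -1`: its `t`-coefficient vanishes
  have star : ∀ p₁ p₂ q₀ q₀', u₁ p₁ q₀ * u₂ p₂ q₀' + u₁ p₁ q₀' * u₂ p₂ q₀ = u₁ p₂ q₀ * u₂ p₁ q₀' + u₁ p₂ q₀' * u₂ p₁ q₀ := by
    intro p₁ p₂ q₀ q₀'
    have h1 := h (fun q => (if q = q₀ then (1 : ℂ) else 0) + 1 * (if q = q₀' then (1 : ℂ) else 0)) p₁ p₂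
    have h2 := h (fun q => (if q = q₀ then (1 : ℂ) else 0) + (-1) * (if q = q₀' then (1 : ℂ) else 0)) p₁ p₂
    rw [row_dot_test, row_dot_test, row_dot_test, row_dot_test] at h1 h2
    linear_combination (1 / 2 : ℂ) * (h1 - h2)
  have e1 := star i k j l
  have e2 := star j l k i
  rw [hu₁ j k, hu₂ l i, hu₁ j i, hu₂ l k, hu₁ l k, hu₂ j i, hu₁ l i, hu₂ j k] at e2
  have h2D : (2 : ℂ) * (u₁ i j * u₂ k l - u₁ k l * u₂ i j) = 0 := by linear_combination e1 + e2
  have hD : u₁ i j * u₂ k l - u₁ k l * u₂ i j = 0 := (mul_eq_zero.mp h2D).resolve_left two_ne_zero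
  exact hne (sub_eq_zero.mp hD)

/-- **Cramer on the contracted pencil equations.**  If `u₁ ⊗ a − u₂ ⊗ b` is symmetric in its last two slots, then for every `w`
and rows `p₁, p₂` (with `Xᵢ = (u₁w)_{pᵢ}`, `Yᵢ = (u₂w)_{pᵢ}`, `σ = a·w`, `τ = b·w`):
`(X₁Y₂ − X₂Y₁)·a_r = σ(Y₂u₁(p₁,r) − Y₁u₁(p₂,r)) + τ(Y₁u₂(p₂,r) − Y₂u₂(p₁,r))` and the analogous formula for `b_r`. [folklore] -/
theorem pencil_cramer (u₁ u₂ : Fin 5 → Fin 5 → ℂ) (a b w : Fin 5 → ℂ)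
    (hS : ∀ p q r, u₁ p q * a r - u₂ p q * b r = u₁ p r * a q - u₂ p r * b q) (p₁ p₂ : Fin 5)
    (X₁ X₂ Y₁ Y₂ σ τ : ℂ) (hX₁ : X₁ = ∑ q, u₁ p₁ q * w q) (hX₂ : X₂ = ∑ q, u₁ p₂ q * w q)
    (hY₁ : Y₁ = ∑ q, u₂ p₁ q * w q) (hY₂ : Y₂ = ∑ q, u₂ p₂ q * w q)
    (hσ : σ = ∑ q, a q * w q) (hτ : τ = ∑ q, b q * w q) :
    (∀ r, (X₁ * Y₂ - X₂ * Y₁) * a r = σ * (Y₂ * u₁ p₁ r - Y₁ * u₁ p₂ r) + τ * (Y₁ * u₂ p₂ r - Y₂ * u₂ p₁ r)) ∧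
    (∀ r, (X₁ * Y₂ - X₂ * Y₁) * b r = σ * (X₂ * u₁ p₁ r - X₁ * u₁ p₂ r) + τ * (X₁ * u₂ p₂ r - X₂ * u₂ p₁ r)) := by
  -- contract the pencil equations against `w` in the middle slot
  have key : ∀ p r, (∑ q, u₁ p q * w q) * a r - (∑ q, u₂ p q * w q) * b r
      = (∑ q, a q * w q) * u₁ p r - (∑ q, b q * w q) * u₂ p r := by
    intro p r
    have h : ∑ q, w q * (u₁ p q * a r - u₂ p q * b r) = ∑ q, w q * (u₁ p r * a q - u₂ p r * b q) :=
      Finset.sum_congr rfl fun q _ => by rw [hS p q r]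
    have lhs : ∑ q, w q * (u₁ p q * a r - u₂ p q * b r) = (∑ q, u₁ p q * w q) * a r - (∑ q, u₂ p q * w q) * b r := by
      rw [Finset.sum_mul, Finset.sum_mul, ← Finset.sum_sub_distrib]
      exact Finset.sum_congr rfl fun q _ => by ring
    have rhs : ∑ q, w q * (u₁ p r * a q - u₂ p r * b q) = (∑ q, a q * w q) * u₁ p r - (∑ q, b q * w q) * u₂ p r := by
      rw [Finset.sum_mul, Finset.sum_mul, ← Finset.sum_sub_distrib]
      exact Finset.sum_congr rfl fun q _ => by ring
    rw [← lhs, ← rhs, h]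
  subst hX₁ hX₂ hY₁ hY₂ hσ hτ
  refine ⟨fun r => ?_, fun r => ?_⟩
  · linear_combination (∑ q, u₂ p₂ q * w q) * key p₁ r - (∑ q, u₂ p₁ q * w q) * key p₂ r
  · linear_combination (∑ q, u₁ p₂ q * w q) * key p₁ r - (∑ q, u₁ p₁ q * w q) * key p₂ r

/-- ★★ **TWO NON-PROPORTIONAL LINES AND A PLANE: `finrank W ≤ 2`.**  `U₀₁ = ℂ·u₁`, `U₀₂ = ℂ·u₂` with `u₁, u₂` symmetric and not
proportional, `U₁₂` symmetric with `finrank U₁₂ ≤ 2`, `W` symmetric zero-diagonal captured by `L3 (ℂ∙u₁) (ℂ∙u₂) U₁₂`: then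
`finrank W ≤ 2`.  (All vector pairs `(a, b)` of all obligations lie in the span of two explicit pairs, by `exists_good_contraction` +
`pencil_cramer`; then ✓ `finrank_le_of_vectorPart`.) [folklore] -/
theorem finrank_le_two_of_nonproportional (u₁ u₂ : Fin 5 → Fin 5 → ℂ)
    (hu₁ : ∀ p q, u₁ p q = u₁ q p) (hu₂ : ∀ p q, u₂ p q = u₂ q p)
    (hnp : ∃ i j k l, u₁ i j * u₂ k l ≠ u₁ k l * u₂ i j)
    (U12 W : Submodule ℂ (Fin 5 → Fin 5 → ℂ)) (hU12 : ∀ x ∈ U12, ∀ p q : Fin 5, x p q = x q p)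
    (h2 : Module.finrank ℂ U12 ≤ 2)
    (hWs : ∀ μ ∈ W, ∀ s t : Fin 5, μ s t = μ t s) (hWd : ∀ μ ∈ W, ∀ s : Fin 5, μ s s = 0)
    (hWc : ∀ μ ∈ W, contractZ μ ∈ L3 (ℂ ∙ u₁) (ℂ ∙ u₂) U12) :
    Module.finrank ℂ W ≤ 2 := by
  classical
  obtain ⟨w, p₁, p₂, hm⟩ := exists_good_contraction u₁ u₂ hu₁ hu₂ hnp
  obtain ⟨v, v', hv, hv', hV⟩ := exists_pair_of_finrank_le_two U12 hU12 h2
  set X₁ := ∑ q, u₁ p₁ q * w q with hX₁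
  set X₂ := ∑ q, u₁ p₂ q * w q with hX₂
  set Y₁ := ∑ q, u₂ p₁ q * w q with hY₁
  set Y₂ := ∑ q, u₂ p₂ q * w q with hY₂
  set m := X₁ * Y₂ - X₂ * Y₁ with hm_def
  -- the two spanning pairs
  let F : (Fin 5 → ℂ) × (Fin 5 → ℂ) :=
    (fun r => Y₂ * u₁ p₁ r - Y₁ * u₁ p₂ r, fun r => X₂ * u₁ p₁ r - X₁ * u₁ p₂ r)
  let G : (Fin 5 → ℂ) × (Fin 5 → ℂ) :=
    (fun r => Y₁ * u₂ p₂ r - Y₂ * u₂ p₁ r, fun r => X₁ * u₂ p₂ r - X₂ * u₂ p₁ r)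
  let AB : Submodule ℂ ((Fin 5 → ℂ) × (Fin 5 → ℂ)) := Submodule.span ℂ {F, G}
  have hAB2 : Module.finrank ℂ AB ≤ 2 := by
    have := finrank_span_le_card (R := ℂ) ({F, G} : Set ((Fin 5 → ℂ) × (Fin 5 → ℂ)))
    refine this.trans ?_
    simp only [Set.toFinset_insert, Set.toFinset_singleton]
    exact Finset.card_insert_le _ _
  have h := finrank_le_of_vectorPart u₁ u₂ U12 W v v' hv hv' hV hWs hWd AB (fun μ hμ => by
    obtain ⟨a, b, C, hC, hT⟩ := vectors_form_of_mem_L3 u₁ u₂ U12 (hWc μ hμ)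
    -- the pencil equations from the `(1 2)` slot symmetry
    have hS : ∀ p q r, u₁ p q * a r - u₂ p q * b r = u₁ p r * a q - u₂ p r * b q := by
      intro p q r
      have h := contractZ_swap23 μ p q r
      rw [hT, hT, hU12 _ (hC p) r q] at h
      linear_combination -h
    obtain ⟨ha, hb⟩ := pencil_cramer u₁ u₂ a b w hS p₁ p₂ X₁ X₂ Y₁ Y₂ (∑ q, a q * w q) (∑ q, b q * w q)
      hX₁ hX₂ hY₁ hY₂ rfl rfl
    refine ⟨a, b, C, ?_, hC, hT⟩
    rw [Submodule.mem_span_pair]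
    refine ⟨m⁻¹ * ∑ q, a q * w q, m⁻¹ * ∑ q, b q * w q, ?_⟩
    ext r
    · have key := ha r
      rw [← hm_def] at key
      have har : a r = m⁻¹ * ((∑ q, a q * w q) * (Y₂ * u₁ p₁ r - Y₁ * u₁ p₂ r)
          + (∑ q, b q * w q) * (Y₁ * u₂ p₂ r - Y₂ * u₂ p₁ r)) := (eq_inv_mul_iff_mul_eq₀ hm).mpr key
      simp only [Prod.fst_add, Prod.smul_fst, Pi.add_apply, Pi.smul_apply, smul_eq_mul, F, G]
      rw [har]; ring
    · have key := hb r
      rw [← hm_def] at key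
      have hbr : b r = m⁻¹ * ((∑ q, a q * w q) * (X₂ * u₁ p₁ r - X₁ * u₁ p₂ r)
          + (∑ q, b q * w q) * (X₁ * u₂ p₂ r - X₂ * u₂ p₁ r)) := (eq_inv_mul_iff_mul_eq₀ hm).mpr key
      simp only [Prod.snd_add, Prod.smul_snd, Pi.add_apply, Pi.smul_apply, smul_eq_mul, F, G]
      rw [hbr]; ring)
  exact h.trans hAB2

/-- ★★ **`CaptureIneqSym` FOR TWO DISTINCT LINES AND A SPAN OF DIMENSION `≤ 2`** (profiles `(1,1,0)`, `(1,1,1)`, `(1,1,2)` with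
`U₀₁ ≠ U₀₂`): `finrank W ≤ finrank U₀₁ + finrank U₀₂ + finrank U₁₂`. [folklore] -/
theorem captureIneqSym_of_nonproportional_lines (u₁ u₂ : Fin 5 → Fin 5 → ℂ)
    (hu₁ : ∀ p q, u₁ p q = u₁ q p) (hu₂ : ∀ p q, u₂ p q = u₂ q p)
    (hnp : ∃ i j k l, u₁ i j * u₂ k l ≠ u₁ k l * u₂ i j)
    (U12 W : Submodule ℂ (Fin 5 → Fin 5 → ℂ)) (hU12 : ∀ x ∈ U12, ∀ p q : Fin 5, x p q = x q p)
    (h2 : Module.finrank ℂ U12 ≤ 2)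
    (hWs : ∀ μ ∈ W, ∀ s t : Fin 5, μ s t = μ t s) (hWd : ∀ μ ∈ W, ∀ s : Fin 5, μ s s = 0)
    (hWc : ∀ μ ∈ W, contractZ μ ∈ L3 (ℂ ∙ u₁) (ℂ ∙ u₂) U12) :
    Module.finrank ℂ W ≤ Module.finrank ℂ (ℂ ∙ u₁) + Module.finrank ℂ (ℂ ∙ u₂) + Module.finrank ℂ U12 := by
  have h := finrank_le_two_of_nonproportional u₁ u₂ hu₁ hu₂ hnp U12 W hU12 h2 hWs hWd hWc
  obtain ⟨i, j, k, l, hne⟩ := hnp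
  have h1 : u₁ ≠ 0 := by
    intro h0; apply hne; rw [h0]; simp
  have h2' : u₂ ≠ 0 := by
    intro h0; apply hne; rw [h0]; simp
  rw [finrank_span_singleton h1, finrank_span_singleton h2']
  omega

end LaplaceFiveSeparatedCapture

end Summit.ValiantsHypothesis.ValiantsHypothesis.Theorems.RigidityForcesSymmetryRankRigidMinimalRepr
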